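import Summits.Ventures.LatticeQCDFlow.Scoring.U1TorusPlaquetteBounds
import HarnessLib

/-!
# Interval arithmetic for the variance of the volume-averaged plaquette of the 2-d `U(1)` torus

HONEST FRAMING: exact (Metropolis-corrected) sampling algorithms for lattice gauge theory;
figures of merit are autocorrelation/cost numbers at stated couplings and volumes; no
continuum-physics claim.

Venture `LatticeQCDFlow` (cell pub-lqcd), sub-topic `Scoring`; FANOUT row 5 (`s0-sun-a`), GEN-13.
NEW WORK of the cell (placement rule): the two purely real-arithmetic steps of the certificate
`Scoring/U1TorusPlaquetteVarianceCertificate.lean` for `Var(P̄) = (S/Z)/V + (1 − 1/V)(P/Z) − (N/Z)²`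
(`Scoring/U1TorusPlaquetteAverageVariance.lean`):

* §1 **`central_units_bounds`** — from `aI₀ ≤ I₁ ≤ bI₀`, `cI₀ ≤ I₂ ≤ dI₀`, `eI₀ ≤ I₃ ≤ fI₀`,
  `0 ≤ I₄ ≤ gI₀` (`a, c, e ≥ 0`), the five central terms (`|k| ≤ 2`) of each of `Z, N, P, S` lie between
  `I₀^V ×` explicit polynomials in `a, …, g` with non-negative coefficients (monotonicity only);
* §2 **`variance_mem_Icc_of_units`** — if `I·X_lo ≤ X ≤ I·X_hi` for `X ∈ {Z, N, P, S}` (`I > 0`,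
  `Z_lo > 0`, `N_lo, P_lo, S_lo ≥ 0`, `V ≥ 1`) then
  `S_lo/(V Z_hi) + (1−1/V) P_lo/Z_hi − (N_hi/Z_lo)² ≤ (S/Z)/V + (1−1/V)(P/Z) − (N/Z)²
   ≤ S_hi/(V Z_lo) + (1−1/V) P_hi/Z_lo − (N_lo/Z_hi)²`.

Elementary; nothing is cited; no `def`.
-/

noncomputable section

open Real Finset

namespace Summit.Ventures.LatticeQCDFlow.Scoring

/-! ### 1. Abstract interval arithmetic for the central terms -/

/-- Monotonicity of `x^n · y`. -/
theorem pow_mul_le_pow_mul {x x' y y' : ℝ} (n : ℕ) (hx : 0 ≤ x) (hy : 0 ≤ y) (hxx : x ≤ x')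
    (hyy : y ≤ y') : x ^ n * y ≤ x' ^ n * y' :=
  mul_le_mul (pow_le_pow_left₀ hx hxx n) hyy hy (pow_nonneg (hx.trans hxx) n)

/-- Monotonicity of `x^n · y²`. -/
theorem pow_mul_sq_le_pow_mul_sq {x x' y y' : ℝ} (n : ℕ) (hx : 0 ≤ x) (hy : 0 ≤ y) (hxx : x ≤ x')
    (hyy : y ≤ y') : x ^ n * y ^ 2 ≤ x' ^ n * y' ^ 2 :=
  mul_le_mul (pow_le_pow_left₀ hx hxx n) (pow_le_pow_left₀ hy hyy 2) (pow_nonneg hy 2)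
    (pow_nonneg (hx.trans hxx) n)

/-- **Central terms, two-sided, in units of `I₀^V`** (`V = W + 3`).  Hypotheses: `I₀,…,I₄ ≥ 0`,
`a, c, e ≥ 0`, `aI₀ ≤ I₁ ≤ bI₀`, `cI₀ ≤ I₂ ≤ dI₀`, `eI₀ ≤ I₃ ≤ fI₀`, `I₄ ≤ gI₀`.  Conclusions, in order:
`Z`-central lower/upper, `N`-central lower/upper, `P`-central lower/upper, `S`-central lower/upper. -/
theorem central_units_bounds {I0 I1 I2 I3 I4 a b c d e f g : ℝ} (W : ℕ) (hI0 : 0 ≤ I0) (hI1 : 0 ≤ I1)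
    (hI2 : 0 ≤ I2) (hI3 : 0 ≤ I3) (hI4 : 0 ≤ I4) (h0a : 0 ≤ a) (h0c : 0 ≤ c) (h0e : 0 ≤ e)
    (h1 : a * I0 ≤ I1) (h1' : I1 ≤ b * I0) (h2 : c * I0 ≤ I2) (h2' : I2 ≤ d * I0)
    (h3 : e * I0 ≤ I3) (h3' : I3 ≤ f * I0) (h4' : I4 ≤ g * I0) :
    (I0 ^ (W + 3) * (1 + 2 * a ^ (W + 3) + 2 * c ^ (W + 3)) ≤
        I0 ^ (W + 3) + 2 * I1 ^ (W + 3) + 2 * I2 ^ (W + 3)) ∧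
    (I0 ^ (W + 3) + 2 * I1 ^ (W + 3) + 2 * I2 ^ (W + 3) ≤
        I0 ^ (W + 3) * (1 + 2 * b ^ (W + 3) + 2 * d ^ (W + 3))) ∧
    (I0 ^ (W + 3) * (a + a ^ (W + 2) * (1 + c) + c ^ (W + 2) * (a + e)) ≤
        I0 ^ (W + 2) * I1 + I1 ^ (W + 2) * (I0 + I2) + I2 ^ (W + 2) * (I1 + I3)) ∧
    (I0 ^ (W + 2) * I1 + I1 ^ (W + 2) * (I0 + I2) + I2 ^ (W + 2) * (I1 + I3) ≤
        I0 ^ (W + 3) * (b + b ^ (W + 2) * (1 + d) + d ^ (W + 2) * (b + f))) ∧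
    (I0 ^ (W + 3) * (a ^ 2 + 2 * a ^ (W + 1) * ((1 + c) / 2) ^ 2 + 2 * c ^ (W + 1) * ((a + e) / 2) ^ 2) ≤
        I0 ^ (W + 1) * I1 ^ 2 + 2 * (I1 ^ (W + 1) * ((I0 + I2) / 2) ^ 2) +
          2 * (I2 ^ (W + 1) * ((I1 + I3) / 2) ^ 2)) ∧
    (I0 ^ (W + 1) * I1 ^ 2 + 2 * (I1 ^ (W + 1) * ((I0 + I2) / 2) ^ 2) +
          2 * (I2 ^ (W + 1) * ((I1 + I3) / 2) ^ 2) ≤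
        I0 ^ (W + 3) * (b ^ 2 + 2 * b ^ (W + 1) * ((1 + d) / 2) ^ 2 + 2 * d ^ (W + 1) * ((b + f) / 2) ^ 2)) ∧
    (I0 ^ (W + 3) * ((1 + c) / 2 + 2 * a ^ (W + 2) * ((3 * a + e) / 4) + 2 * c ^ (W + 2) * ((1 + 2 * c) / 4)) ≤
        I0 ^ (W + 2) * ((I0 + I2) / 2) + 2 * (I1 ^ (W + 2) * ((3 * I1 + I3) / 4)) +
          2 * (I2 ^ (W + 2) * ((I0 + 2 * I2 + I4) / 4))) ∧
    (I0 ^ (W + 2) * ((I0 + I2) / 2) + 2 * (I1 ^ (W + 2) * ((3 * I1 + I3) / 4)) +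
          2 * (I2 ^ (W + 2) * ((I0 + 2 * I2 + I4) / 4)) ≤
        I0 ^ (W + 3) * ((1 + d) / 2 + 2 * b ^ (W + 2) * ((3 * b + f) / 4) +
          2 * d ^ (W + 2) * ((1 + 2 * d + g) / 4))) := by
  have haI : 0 ≤ a * I0 := mul_nonneg h0a hI0
  have hcI : 0 ≤ c * I0 := mul_nonneg h0c hI0
  have heI : 0 ≤ e * I0 := mul_nonneg h0e hI0
  refine ⟨?_, ?_, ?_, ?_, ?_, ?_, ?_, ?_⟩
  · have t1 := pow_le_pow_left₀ haI h1 (W + 3)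
    have t2 := pow_le_pow_left₀ hcI h2 (W + 3)
    rw [mul_pow] at t1 t2
    nlinarith
  · have t1 := pow_le_pow_left₀ hI1 h1' (W + 3)
    have t2 := pow_le_pow_left₀ hI2 h2' (W + 3)
    rw [mul_pow] at t1 t2
    nlinarith
  · have t1 := pow_mul_le_pow_mul (W + 2) hI0 haI le_rfl h1
    have t2 := pow_mul_le_pow_mul (W + 2) haI (by positivity : 0 ≤ I0 + c * I0) h1
      (by linarith : I0 + c * I0 ≤ I0 + I2)
    have t3 := pow_mul_le_pow_mul (W + 2) hcI (by positivity : 0 ≤ a * I0 + e * I0) h2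
      (by linarith : a * I0 + e * I0 ≤ I1 + I3)
    calc I0 ^ (W + 3) * (a + a ^ (W + 2) * (1 + c) + c ^ (W + 2) * (a + e))
        = I0 ^ (W + 2) * (a * I0) + (a * I0) ^ (W + 2) * (I0 + c * I0) +
            (c * I0) ^ (W + 2) * (a * I0 + e * I0) := by ring
      _ ≤ _ := by linarith
  · have t1 := pow_mul_le_pow_mul (W + 2) hI0 hI1 le_rfl h1'
    have t2 := pow_mul_le_pow_mul (W + 2) hI1 (by positivity : 0 ≤ I0 + I2) h1'
      (by linarith : I0 + I2 ≤ I0 + d * I0)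
    have t3 := pow_mul_le_pow_mul (W + 2) hI2 (by positivity : 0 ≤ I1 + I3) h2'
      (by linarith : I1 + I3 ≤ b * I0 + f * I0)
    calc I0 ^ (W + 2) * I1 + I1 ^ (W + 2) * (I0 + I2) + I2 ^ (W + 2) * (I1 + I3)
        ≤ I0 ^ (W + 2) * (b * I0) + (b * I0) ^ (W + 2) * (I0 + d * I0) +
            (d * I0) ^ (W + 2) * (b * I0 + f * I0) := by linarith
      _ = _ := by ring
  · have t1 := pow_mul_sq_le_pow_mul_sq (W + 1) hI0 haI le_rfl h1
    have t2 := pow_mul_sq_le_pow_mul_sq (W + 1) haI (by positivity : 0 ≤ (I0 + c * I0) / 2) h1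
      (by linarith : (I0 + c * I0) / 2 ≤ (I0 + I2) / 2)
    have t3 := pow_mul_sq_le_pow_mul_sq (W + 1) hcI (by positivity : 0 ≤ (a * I0 + e * I0) / 2) h2
      (by linarith : (a * I0 + e * I0) / 2 ≤ (I1 + I3) / 2)
    calc I0 ^ (W + 3) * (a ^ 2 + 2 * a ^ (W + 1) * ((1 + c) / 2) ^ 2 +
          2 * c ^ (W + 1) * ((a + e) / 2) ^ 2)
        = I0 ^ (W + 1) * (a * I0) ^ 2 + 2 * ((a * I0) ^ (W + 1) * ((I0 + c * I0) / 2) ^ 2) +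
            2 * ((c * I0) ^ (W + 1) * ((a * I0 + e * I0) / 2) ^ 2) := by ring
      _ ≤ _ := by linarith
  · have t1 := pow_mul_sq_le_pow_mul_sq (W + 1) hI0 hI1 le_rfl h1'
    have t2 := pow_mul_sq_le_pow_mul_sq (W + 1) hI1 (by positivity : 0 ≤ (I0 + I2) / 2) h1'
      (by linarith : (I0 + I2) / 2 ≤ (I0 + d * I0) / 2)
    have t3 := pow_mul_sq_le_pow_mul_sq (W + 1) hI2 (by positivity : 0 ≤ (I1 + I3) / 2) h2'
      (by linarith : (I1 + I3) / 2 ≤ (b * I0 + f * I0) / 2)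
    calc I0 ^ (W + 1) * I1 ^ 2 + 2 * (I1 ^ (W + 1) * ((I0 + I2) / 2) ^ 2) +
          2 * (I2 ^ (W + 1) * ((I1 + I3) / 2) ^ 2)
        ≤ I0 ^ (W + 1) * (b * I0) ^ 2 + 2 * ((b * I0) ^ (W + 1) * ((I0 + d * I0) / 2) ^ 2) +
            2 * ((d * I0) ^ (W + 1) * ((b * I0 + f * I0) / 2) ^ 2) := by linarith
      _ = _ := by ring
  · have t1 := pow_mul_le_pow_mul (W + 2) hI0 (by positivity : 0 ≤ (I0 + c * I0) / 2) le_rfl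
      (by linarith : (I0 + c * I0) / 2 ≤ (I0 + I2) / 2)
    have t2 := pow_mul_le_pow_mul (W + 2) haI (by positivity : 0 ≤ (3 * (a * I0) + e * I0) / 4) h1
      (by linarith : (3 * (a * I0) + e * I0) / 4 ≤ (3 * I1 + I3) / 4)
    have t3 := pow_mul_le_pow_mul (W + 2) hcI (by positivity : 0 ≤ (I0 + 2 * (c * I0) + 0) / 4) h2
      (by linarith : (I0 + 2 * (c * I0) + 0) / 4 ≤ (I0 + 2 * I2 + I4) / 4)
    calc I0 ^ (W + 3) * ((1 + c) / 2 + 2 * a ^ (W + 2) * ((3 * a + e) / 4) +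
          2 * c ^ (W + 2) * ((1 + 2 * c) / 4))
        = I0 ^ (W + 2) * ((I0 + c * I0) / 2) + 2 * ((a * I0) ^ (W + 2) * ((3 * (a * I0) + e * I0) / 4)) +
            2 * ((c * I0) ^ (W + 2) * ((I0 + 2 * (c * I0) + 0) / 4)) := by ring
      _ ≤ _ := by linarith
  · have t1 := pow_mul_le_pow_mul (W + 2) hI0 (by positivity : 0 ≤ (I0 + I2) / 2) le_rfl
      (by linarith : (I0 + I2) / 2 ≤ (I0 + d * I0) / 2)
    have t2 := pow_mul_le_pow_mul (W + 2) hI1 (by positivity : 0 ≤ (3 * I1 + I3) / 4) h1'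
      (by linarith : (3 * I1 + I3) / 4 ≤ (3 * (b * I0) + f * I0) / 4)
    have t3 := pow_mul_le_pow_mul (W + 2) hI2 (by positivity : 0 ≤ (I0 + 2 * I2 + I4) / 4) h2'
      (by linarith : (I0 + 2 * I2 + I4) / 4 ≤ (I0 + 2 * (d * I0) + g * I0) / 4)
    calc I0 ^ (W + 2) * ((I0 + I2) / 2) + 2 * (I1 ^ (W + 2) * ((3 * I1 + I3) / 4)) +
          2 * (I2 ^ (W + 2) * ((I0 + 2 * I2 + I4) / 4))
        ≤ I0 ^ (W + 2) * ((I0 + d * I0) / 2) + 2 * ((b * I0) ^ (W + 2) * ((3 * (b * I0) + f * I0) / 4)) +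
            2 * ((d * I0) ^ (W + 2) * ((I0 + 2 * (d * I0) + g * I0) / 4)) := by linarith
      _ = _ := by ring

/-! ### 2. Monotone combination -/

/-- **From units bounds to the variance.**  If `0 < I`, `1 ≤ V`, `0 < Z_lo`, `0 ≤ N_lo, P_lo, S_lo` and
`I·X_lo ≤ X ≤ I·X_hi` for `X ∈ {Z, N, P, S}`, then
`S_lo/(V Z_hi) + (1−1/V)(P_lo/Z_hi) − (N_hi/Z_lo)² ≤ (S/Z)/V + (1−1/V)(P/Z) − (N/Z)²
 ≤ S_hi/(V Z_lo) + (1−1/V)(P_hi/Z_lo) − (N_lo/Z_hi)²`. -/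
theorem variance_mem_Icc_of_units {I Z N P S Zl Zh Nl Nh Pl Ph Sl Sh V : ℝ} (hI : 0 < I)
    (hV : 1 ≤ V) (hZl : 0 < Zl) (hNl : 0 ≤ Nl) (hPl : 0 ≤ Pl) (hSl : 0 ≤ Sl)
    (hZ1 : I * Zl ≤ Z) (hZ2 : Z ≤ I * Zh) (hN1 : I * Nl ≤ N) (hN2 : N ≤ I * Nh)
    (hP1 : I * Pl ≤ P) (hP2 : P ≤ I * Ph) (hS1 : I * Sl ≤ S) (hS2 : S ≤ I * Sh) :
    Sl / (V * Zh) + (1 - 1 / V) * (Pl / Zh) - (Nh / Zl) ^ 2 ≤ S / Z / V + (1 - 1 / V) * (P / Z) - (N / Z) ^ 2 ∧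
    S / Z / V + (1 - 1 / V) * (P / Z) - (N / Z) ^ 2 ≤ Sh / (V * Zl) + (1 - 1 / V) * (Ph / Zl) - (Nl / Zh) ^ 2 := by
  have hZ : 0 < Z := lt_of_lt_of_le (mul_pos hI hZl) hZ1
  have hIZh : 0 < I * Zh := hZ.trans_le hZ2
  have hZh : 0 < Zh := pos_of_mul_pos_right hIZh hI.le
  have hV0 : 0 < V := by linarith
  have hV1 : 0 ≤ 1 - 1 / V := by
    rw [sub_nonneg, div_le_one hV0]; exact hV
  have hN0 : 0 ≤ N := (mul_nonneg hI.le hNl).trans hN1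
  have hP0 : 0 ≤ P := (mul_nonneg hI.le hPl).trans hP1
  have hS0 : 0 ≤ S := (mul_nonneg hI.le hSl).trans hS1
  -- the six ratio bounds
  have rS1 : Sl / Zh ≤ S / Z := by
    calc Sl / Zh = (I * Sl) / (I * Zh) := (mul_div_mul_left _ _ hI.ne').symm
      _ ≤ S / Z := div_le_div₀ hS0 hS1 hZ hZ2
  have rS2 : S / Z ≤ Sh / Zl := by
    calc S / Z ≤ (I * Sh) / (I * Zl) := div_le_div₀ (hS0.trans hS2) hS2 (mul_pos hI hZl) hZ1
      _ = Sh / Zl := mul_div_mul_left _ _ hI.ne'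
  have rP1 : Pl / Zh ≤ P / Z := by
    calc Pl / Zh = (I * Pl) / (I * Zh) := (mul_div_mul_left _ _ hI.ne').symm
      _ ≤ P / Z := div_le_div₀ hP0 hP1 hZ hZ2
  have rP2 : P / Z ≤ Ph / Zl := by
    calc P / Z ≤ (I * Ph) / (I * Zl) := div_le_div₀ (hP0.trans hP2) hP2 (mul_pos hI hZl) hZ1
      _ = Ph / Zl := mul_div_mul_left _ _ hI.ne'
  have rN1 : Nl / Zh ≤ N / Z := by
    calc Nl / Zh = (I * Nl) / (I * Zh) := (mul_div_mul_left _ _ hI.ne').symm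
      _ ≤ N / Z := div_le_div₀ hN0 hN1 hZ hZ2
  have rN2 : N / Z ≤ Nh / Zl := by
    calc N / Z ≤ (I * Nh) / (I * Zl) := div_le_div₀ (hN0.trans hN2) hN2 (mul_pos hI hZl) hZ1
      _ = Nh / Zl := mul_div_mul_left _ _ hI.ne'
  have hNZ0 : 0 ≤ N / Z := div_nonneg hN0 hZ.le
  have hNlZh : 0 ≤ Nl / Zh := div_nonneg hNl hZh.le
  have sq1 : (Nl / Zh) ^ 2 ≤ (N / Z) ^ 2 := pow_le_pow_left₀ hNlZh rN1 2
  have sq2 : (N / Z) ^ 2 ≤ (Nh / Zl) ^ 2 := pow_le_pow_left₀ hNZ0 rN2 2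
  have e1 : Sl / (V * Zh) = Sl / Zh / V := by rw [mul_comm, div_div]
  have e2 : Sh / (V * Zl) = Sh / Zl / V := by rw [mul_comm, div_div]
  rw [e1, e2]
  constructor
  · have t1 : Sl / Zh / V ≤ S / Z / V := div_le_div_of_nonneg_right rS1 hV0.le
    have t2 : (1 - 1 / V) * (Pl / Zh) ≤ (1 - 1 / V) * (P / Z) := mul_le_mul_of_nonneg_left rP1 hV1
    linarith
  · have t1 : S / Z / V ≤ Sh / Zl / V := div_le_div_of_nonneg_right rS2 hV0.le
    have t2 : (1 - 1 / V) * (P / Z) ≤ (1 - 1 / V) * (Ph / Zl) := mul_le_mul_of_nonneg_left rP2 hV1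
    linarith

end Summit.Ventures.LatticeQCDFlow.Scoring
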